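import Literature.Algebra.Lie.FreeLieAlgebraGrading
import Literature.Algebra.Lie.FreeLieRingEmbedding
import Mathlib.Tactic.Module
import HarnessLib

/-!
# Helper I (Lie side) for stub `stub_layerStepZeroOne` of line `nilpotent-genus-class`, crux
`CongruenceShadows.ShadowApproximation` (item stmt-SmoothPoincare4-14595)

Pure algebra in the free Lie ring `L = L_ℤ(y₀, y₁, y₂)` (Mathlib's `FreeLieAlgebra ℤ (Fin 3)`), the
graded Lie ring of the free group `S₃ ⧸ N₂ = F⟨a₀, b₁, b₂⟩` (Magnus–Witt, landed as `stub_freeGroupGrLie`).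
The layer step `(m,c) = (0,1)` of the line (2-step → 3-step nilpotent at genus `3`) reduces to the
following statement in degree `3` of `L` ("Goeritz–Johnson surjectivity modulo the cut ideal in degree
two", `GJ₂(0)` of the worker evidence `evidence-layer01.md` on the item):

* the honest degree-two data of a third kernel `K₂` with `K₂γ₃ = N₂γ₃` form a triple `D ∈ L₃³` subject to
  the constraint `⁅y₀, D₀⁆ + ⁅D₁, y₁⁆ + ⁅D₂, y₂⁆ = 0` (the image of the surface relator in the FREE group
  `S₃ ⧸ K₂`);
* **`lie_realise`**: every such triple is an INTEGER combination of the six twist data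
  (the data of the six separating twists `x_k T_{h_k} x_k⁻¹` of the group side, recorded here by their
  integer coordinates in the eight basic brackets).

Ingredients: `L₃` is spanned by the eight right-normed basic brackets (`L3_le_span`, Jacobi by hand);
integer coordinates (`exists_coords`); coefficient functionals through Witt's embedding
`toTensor : L ↪ ℤ⟨y₀,y₁,y₂⟩` (`tc_lie_lie`, `coeff_constraint`: the constraint says that the coefficient
tensor is invariant under the cyclic rotation of its four indices); the resulting `18` sparse integer
equations cut the `24` coordinates down to the rank-`6` lattice spanned (with index `1`) by the six twist
data.  The certificate was found with exact integer linear algebra (seat folder `work/stubs/l01/`) and is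
rechecked here by `simp`/`module`/`linarith`.  No definitions, no notations (the two literal tables are written out).
Registered sub-goal: `helper_layerZeroOneLieSpan` (the spanning statement in closed form).
-/

set_option linter.dupNamespace false

noncomputable section

open Literature.Algebra.Lie

namespace Summit.SmoothPoincare4.SmoothPoincare4.Theorems.ShadowApproximation.NilpotentGenusClass

namespace LayerZeroOne

/-! Throughout, the EIGHT BASIC BRACKETS are the right-normed `⁅y_a, ⁅y_b, y_c⁆⁆`, `b < c`,
`(a,b,c) ≠ (1,0,2)` (a Hall basis of the rank-`8` free `ℤ`-module `L₃(ℤ³)`), in the order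
`(0,0,1), (0,0,2), (0,1,2), (1,0,1), (1,1,2), (2,0,1), (2,0,2), (2,1,2)`, written as a literal table
`![…] : Fin 8 → L`. -/

/-! ## Rewriting triple brackets into the basis -/

/-- `⁅⁅u, v⁆, w⁆ = -⁅w, ⁅u, v⁆⁆`. [folklore] -/
theorem lie_lie_eq_neg (u v w : FreeLieAlgebra ℤ (Fin 3)) : ⁅⁅u, v⁆, w⁆ = -⁅w, ⁅u, v⁆⁆ := (lie_skew _ _).symm

/-- Inner reordering `⁅u, ⁅y₁, y₀⁆⁆ = -⁅u, ⁅y₀, y₁⁆⁆`. [folklore] -/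
theorem inner_10 (u : FreeLieAlgebra ℤ (Fin 3)) : ⁅u, ⁅FreeLieAlgebra.of ℤ (1 : Fin 3), FreeLieAlgebra.of ℤ (0 : Fin 3)⁆⁆ = -⁅u, ⁅FreeLieAlgebra.of ℤ (0 : Fin 3), FreeLieAlgebra.of ℤ (1 : Fin 3)⁆⁆ := by
  rw [← lie_skew (FreeLieAlgebra.of ℤ (0 : Fin 3)) (FreeLieAlgebra.of ℤ (1 : Fin 3)), lie_neg, neg_neg]

/-- Inner reordering `⁅u, ⁅y₂, y₀⁆⁆ = -⁅u, ⁅y₀, y₂⁆⁆`. [folklore] -/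
theorem inner_20 (u : FreeLieAlgebra ℤ (Fin 3)) : ⁅u, ⁅FreeLieAlgebra.of ℤ (2 : Fin 3), FreeLieAlgebra.of ℤ (0 : Fin 3)⁆⁆ = -⁅u, ⁅FreeLieAlgebra.of ℤ (0 : Fin 3), FreeLieAlgebra.of ℤ (2 : Fin 3)⁆⁆ := by
  rw [← lie_skew (FreeLieAlgebra.of ℤ (0 : Fin 3)) (FreeLieAlgebra.of ℤ (2 : Fin 3)), lie_neg, neg_neg]

/-- Inner reordering `⁅u, ⁅y₂, y₁⁆⁆ = -⁅u, ⁅y₁, y₂⁆⁆`. [folklore] -/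
theorem inner_21 (u : FreeLieAlgebra ℤ (Fin 3)) : ⁅u, ⁅FreeLieAlgebra.of ℤ (2 : Fin 3), FreeLieAlgebra.of ℤ (1 : Fin 3)⁆⁆ = -⁅u, ⁅FreeLieAlgebra.of ℤ (1 : Fin 3), FreeLieAlgebra.of ℤ (2 : Fin 3)⁆⁆ := by
  rw [← lie_skew (FreeLieAlgebra.of ℤ (1 : Fin 3)) (FreeLieAlgebra.of ℤ (2 : Fin 3)), lie_neg, neg_neg]

/-- The Jacobi relation `⁅y₁, ⁅y₀, y₂⁆⁆ = ⁅y₀, ⁅y₁, y₂⁆⁆ + ⁅y₂, ⁅y₀, y₁⁆⁆` (the only right-normed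
bracket with increasing inner pair which is not basic). [folklore] -/
theorem jacobi_102 : ⁅FreeLieAlgebra.of ℤ (1 : Fin 3), ⁅FreeLieAlgebra.of ℤ (0 : Fin 3), FreeLieAlgebra.of ℤ (2 : Fin 3)⁆⁆ = ⁅FreeLieAlgebra.of ℤ (0 : Fin 3), ⁅FreeLieAlgebra.of ℤ (1 : Fin 3), FreeLieAlgebra.of ℤ (2 : Fin 3)⁆⁆ + ⁅FreeLieAlgebra.of ℤ (2 : Fin 3), ⁅FreeLieAlgebra.of ℤ (0 : Fin 3), FreeLieAlgebra.of ℤ (1 : Fin 3)⁆⁆ := by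
  have h1 := leibniz_lie (FreeLieAlgebra.of ℤ (1 : Fin 3)) (FreeLieAlgebra.of ℤ (0 : Fin 3)) (FreeLieAlgebra.of ℤ (2 : Fin 3))
  have h2 : ⁅⁅FreeLieAlgebra.of ℤ (1 : Fin 3), FreeLieAlgebra.of ℤ (0 : Fin 3)⁆, FreeLieAlgebra.of ℤ (2 : Fin 3)⁆ = ⁅FreeLieAlgebra.of ℤ (2 : Fin 3), ⁅FreeLieAlgebra.of ℤ (0 : Fin 3), FreeLieAlgebra.of ℤ (1 : Fin 3)⁆⁆ := by
    rw [lie_lie_eq_neg, inner_10, neg_neg]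
  rw [h1, h2, add_comm]

/-- Every right-normed triple bracket of letters lies in the span of the eight basic ones. [folklore] -/
theorem lie_lie_mem_span (a b c : Fin 3) :
    ⁅FreeLieAlgebra.of ℤ a, ⁅FreeLieAlgebra.of ℤ b, FreeLieAlgebra.of ℤ c⁆⁆ ∈ Submodule.span ℤ (Set.range (![⁅FreeLieAlgebra.of ℤ (0 : Fin 3), ⁅FreeLieAlgebra.of ℤ (0 : Fin 3), FreeLieAlgebra.of ℤ (1 : Fin 3)⁆⁆,
    ⁅FreeLieAlgebra.of ℤ (0 : Fin 3), ⁅FreeLieAlgebra.of ℤ (0 : Fin 3), FreeLieAlgebra.of ℤ (2 : Fin 3)⁆⁆,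
    ⁅FreeLieAlgebra.of ℤ (0 : Fin 3), ⁅FreeLieAlgebra.of ℤ (1 : Fin 3), FreeLieAlgebra.of ℤ (2 : Fin 3)⁆⁆,
    ⁅FreeLieAlgebra.of ℤ (1 : Fin 3), ⁅FreeLieAlgebra.of ℤ (0 : Fin 3), FreeLieAlgebra.of ℤ (1 : Fin 3)⁆⁆,
    ⁅FreeLieAlgebra.of ℤ (1 : Fin 3), ⁅FreeLieAlgebra.of ℤ (1 : Fin 3), FreeLieAlgebra.of ℤ (2 : Fin 3)⁆⁆,
    ⁅FreeLieAlgebra.of ℤ (2 : Fin 3), ⁅FreeLieAlgebra.of ℤ (0 : Fin 3), FreeLieAlgebra.of ℤ (1 : Fin 3)⁆⁆,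
    ⁅FreeLieAlgebra.of ℤ (2 : Fin 3), ⁅FreeLieAlgebra.of ℤ (0 : Fin 3), FreeLieAlgebra.of ℤ (2 : Fin 3)⁆⁆,
    ⁅FreeLieAlgebra.of ℤ (2 : Fin 3), ⁅FreeLieAlgebra.of ℤ (1 : Fin 3), FreeLieAlgebra.of ℤ (2 : Fin 3)⁆⁆] :
      Fin 8 → FreeLieAlgebra ℤ (Fin 3))) := by
  set B : Fin 8 → FreeLieAlgebra ℤ (Fin 3) := (![⁅FreeLieAlgebra.of ℤ (0 : Fin 3), ⁅FreeLieAlgebra.of ℤ (0 : Fin 3), FreeLieAlgebra.of ℤ (1 : Fin 3)⁆⁆,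
    ⁅FreeLieAlgebra.of ℤ (0 : Fin 3), ⁅FreeLieAlgebra.of ℤ (0 : Fin 3), FreeLieAlgebra.of ℤ (2 : Fin 3)⁆⁆,
    ⁅FreeLieAlgebra.of ℤ (0 : Fin 3), ⁅FreeLieAlgebra.of ℤ (1 : Fin 3), FreeLieAlgebra.of ℤ (2 : Fin 3)⁆⁆,
    ⁅FreeLieAlgebra.of ℤ (1 : Fin 3), ⁅FreeLieAlgebra.of ℤ (0 : Fin 3), FreeLieAlgebra.of ℤ (1 : Fin 3)⁆⁆,
    ⁅FreeLieAlgebra.of ℤ (1 : Fin 3), ⁅FreeLieAlgebra.of ℤ (1 : Fin 3), FreeLieAlgebra.of ℤ (2 : Fin 3)⁆⁆,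
    ⁅FreeLieAlgebra.of ℤ (2 : Fin 3), ⁅FreeLieAlgebra.of ℤ (0 : Fin 3), FreeLieAlgebra.of ℤ (1 : Fin 3)⁆⁆,
    ⁅FreeLieAlgebra.of ℤ (2 : Fin 3), ⁅FreeLieAlgebra.of ℤ (0 : Fin 3), FreeLieAlgebra.of ℤ (2 : Fin 3)⁆⁆,
    ⁅FreeLieAlgebra.of ℤ (2 : Fin 3), ⁅FreeLieAlgebra.of ℤ (1 : Fin 3), FreeLieAlgebra.of ℤ (2 : Fin 3)⁆⁆] :
      Fin 8 → FreeLieAlgebra ℤ (Fin 3)) with hB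
  have H : ∀ l, B l ∈ Submodule.span ℤ (Set.range B) := fun l => Submodule.subset_span ⟨l, rfl⟩
  have H0 := H 0; have H1 := H 1; have H2 := H 2; have H3 := H 3
  have H4 := H 4; have H5 := H 5; have H6 := H 6; have H7 := H 7
  simp only [hB, Matrix.cons_val] at H0 H1 H2 H3 H4 H5 H6 H7
  fin_cases a <;> fin_cases b <;> fin_cases c <;>
    simp only [Fin.zero_eta, Fin.mk_one, Fin.reduceFinMk, Fin.isValue, lie_self, lie_zero,
      Submodule.zero_mem, inner_10, inner_20, inner_21, jacobi_102, Submodule.neg_mem_iff, neg_add] <;>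
    first
    | assumption
    | exact Submodule.add_mem _ H2 H5
    | exact Submodule.add_mem _ ((Submodule.neg_mem_iff _).2 H2) ((Submodule.neg_mem_iff _).2 H5)

/-- **`L₃` is spanned by the eight basic brackets.** [folklore] -/
theorem L3_le_span : wordGrade ℤ (FreeLieAlgebra.of ℤ : Fin 3 → FreeLieAlgebra ℤ (Fin 3)) 3 ≤
    Submodule.span ℤ (Set.range (![⁅FreeLieAlgebra.of ℤ (0 : Fin 3), ⁅FreeLieAlgebra.of ℤ (0 : Fin 3), FreeLieAlgebra.of ℤ (1 : Fin 3)⁆⁆,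
    ⁅FreeLieAlgebra.of ℤ (0 : Fin 3), ⁅FreeLieAlgebra.of ℤ (0 : Fin 3), FreeLieAlgebra.of ℤ (2 : Fin 3)⁆⁆,
    ⁅FreeLieAlgebra.of ℤ (0 : Fin 3), ⁅FreeLieAlgebra.of ℤ (1 : Fin 3), FreeLieAlgebra.of ℤ (2 : Fin 3)⁆⁆,
    ⁅FreeLieAlgebra.of ℤ (1 : Fin 3), ⁅FreeLieAlgebra.of ℤ (0 : Fin 3), FreeLieAlgebra.of ℤ (1 : Fin 3)⁆⁆,
    ⁅FreeLieAlgebra.of ℤ (1 : Fin 3), ⁅FreeLieAlgebra.of ℤ (1 : Fin 3), FreeLieAlgebra.of ℤ (2 : Fin 3)⁆⁆,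
    ⁅FreeLieAlgebra.of ℤ (2 : Fin 3), ⁅FreeLieAlgebra.of ℤ (0 : Fin 3), FreeLieAlgebra.of ℤ (1 : Fin 3)⁆⁆,
    ⁅FreeLieAlgebra.of ℤ (2 : Fin 3), ⁅FreeLieAlgebra.of ℤ (0 : Fin 3), FreeLieAlgebra.of ℤ (2 : Fin 3)⁆⁆,
    ⁅FreeLieAlgebra.of ℤ (2 : Fin 3), ⁅FreeLieAlgebra.of ℤ (1 : Fin 3), FreeLieAlgebra.of ℤ (2 : Fin 3)⁆⁆] :
      Fin 8 → FreeLieAlgebra ℤ (Fin 3))) := by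
  refine (wordGrade_succ_succ_le_span_lie _ 1).trans (Submodule.span_le.2 ?_)
  rintro _ ⟨x, u, hu, rfl⟩
  have hu' := wordGrade_succ_succ_le_span_lie (R := ℤ) (FreeLieAlgebra.of ℤ : Fin 3 → FreeLieAlgebra ℤ (Fin 3)) 0 hu
  refine Submodule.span_induction (p := fun u _ => ⁅FreeLieAlgebra.of ℤ x, u⁆ ∈ Submodule.span ℤ (Set.range (![⁅FreeLieAlgebra.of ℤ (0 : Fin 3), ⁅FreeLieAlgebra.of ℤ (0 : Fin 3), FreeLieAlgebra.of ℤ (1 : Fin 3)⁆⁆,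
    ⁅FreeLieAlgebra.of ℤ (0 : Fin 3), ⁅FreeLieAlgebra.of ℤ (0 : Fin 3), FreeLieAlgebra.of ℤ (2 : Fin 3)⁆⁆,
    ⁅FreeLieAlgebra.of ℤ (0 : Fin 3), ⁅FreeLieAlgebra.of ℤ (1 : Fin 3), FreeLieAlgebra.of ℤ (2 : Fin 3)⁆⁆,
    ⁅FreeLieAlgebra.of ℤ (1 : Fin 3), ⁅FreeLieAlgebra.of ℤ (0 : Fin 3), FreeLieAlgebra.of ℤ (1 : Fin 3)⁆⁆,
    ⁅FreeLieAlgebra.of ℤ (1 : Fin 3), ⁅FreeLieAlgebra.of ℤ (1 : Fin 3), FreeLieAlgebra.of ℤ (2 : Fin 3)⁆⁆,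
    ⁅FreeLieAlgebra.of ℤ (2 : Fin 3), ⁅FreeLieAlgebra.of ℤ (0 : Fin 3), FreeLieAlgebra.of ℤ (1 : Fin 3)⁆⁆,
    ⁅FreeLieAlgebra.of ℤ (2 : Fin 3), ⁅FreeLieAlgebra.of ℤ (0 : Fin 3), FreeLieAlgebra.of ℤ (2 : Fin 3)⁆⁆,
    ⁅FreeLieAlgebra.of ℤ (2 : Fin 3), ⁅FreeLieAlgebra.of ℤ (1 : Fin 3), FreeLieAlgebra.of ℤ (2 : Fin 3)⁆⁆] :
      Fin 8 → FreeLieAlgebra ℤ (Fin 3))))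
    ?_ ?_ ?_ ?_ hu'
  · rintro _ ⟨x', u', hu', rfl⟩
    rw [zero_add, wordGrade_one] at hu'
    refine Submodule.span_induction
      (p := fun u' _ => ⁅FreeLieAlgebra.of ℤ x, ⁅FreeLieAlgebra.of ℤ x', u'⁆⁆ ∈ Submodule.span ℤ (Set.range (![⁅FreeLieAlgebra.of ℤ (0 : Fin 3), ⁅FreeLieAlgebra.of ℤ (0 : Fin 3), FreeLieAlgebra.of ℤ (1 : Fin 3)⁆⁆,
    ⁅FreeLieAlgebra.of ℤ (0 : Fin 3), ⁅FreeLieAlgebra.of ℤ (0 : Fin 3), FreeLieAlgebra.of ℤ (2 : Fin 3)⁆⁆,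
    ⁅FreeLieAlgebra.of ℤ (0 : Fin 3), ⁅FreeLieAlgebra.of ℤ (1 : Fin 3), FreeLieAlgebra.of ℤ (2 : Fin 3)⁆⁆,
    ⁅FreeLieAlgebra.of ℤ (1 : Fin 3), ⁅FreeLieAlgebra.of ℤ (0 : Fin 3), FreeLieAlgebra.of ℤ (1 : Fin 3)⁆⁆,
    ⁅FreeLieAlgebra.of ℤ (1 : Fin 3), ⁅FreeLieAlgebra.of ℤ (1 : Fin 3), FreeLieAlgebra.of ℤ (2 : Fin 3)⁆⁆,
    ⁅FreeLieAlgebra.of ℤ (2 : Fin 3), ⁅FreeLieAlgebra.of ℤ (0 : Fin 3), FreeLieAlgebra.of ℤ (1 : Fin 3)⁆⁆,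
    ⁅FreeLieAlgebra.of ℤ (2 : Fin 3), ⁅FreeLieAlgebra.of ℤ (0 : Fin 3), FreeLieAlgebra.of ℤ (2 : Fin 3)⁆⁆,
    ⁅FreeLieAlgebra.of ℤ (2 : Fin 3), ⁅FreeLieAlgebra.of ℤ (1 : Fin 3), FreeLieAlgebra.of ℤ (2 : Fin 3)⁆⁆] :
      Fin 8 → FreeLieAlgebra ℤ (Fin 3))))
      ?_ ?_ ?_ ?_ hu'
    · rintro _ ⟨x'', rfl⟩
      exact lie_lie_mem_span x x' x''
    · rw [lie_zero, lie_zero]; exact Submodule.zero_mem _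
    · intro v w _ _ hv hw
      rw [lie_add, lie_add]; exact Submodule.add_mem _ hv hw
    · intro n v _ hv
      rw [lie_smul, lie_smul]; exact Submodule.smul_mem _ n hv
  · rw [lie_zero]; exact Submodule.zero_mem _
  · intro v w _ _ hv hw
    rw [lie_add]; exact Submodule.add_mem _ hv hw
  · intro n v _ hv
    rw [lie_smul]; exact Submodule.smul_mem _ n hv

/-- Coordinates: every element of `L₃` is an integer combination of the basic brackets. [folklore] -/
theorem exists_coords {u : FreeLieAlgebra ℤ (Fin 3)} (hu : u ∈ wordGrade ℤ (FreeLieAlgebra.of ℤ : Fin 3 → FreeLieAlgebra ℤ (Fin 3)) 3) : ∃ c : Fin 8 → ℤ, u = ∑ l, c l • (![⁅FreeLieAlgebra.of ℤ (0 : Fin 3), ⁅FreeLieAlgebra.of ℤ (0 : Fin 3), FreeLieAlgebra.of ℤ (1 : Fin 3)⁆⁆,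
    ⁅FreeLieAlgebra.of ℤ (0 : Fin 3), ⁅FreeLieAlgebra.of ℤ (0 : Fin 3), FreeLieAlgebra.of ℤ (2 : Fin 3)⁆⁆,
    ⁅FreeLieAlgebra.of ℤ (0 : Fin 3), ⁅FreeLieAlgebra.of ℤ (1 : Fin 3), FreeLieAlgebra.of ℤ (2 : Fin 3)⁆⁆,
    ⁅FreeLieAlgebra.of ℤ (1 : Fin 3), ⁅FreeLieAlgebra.of ℤ (0 : Fin 3), FreeLieAlgebra.of ℤ (1 : Fin 3)⁆⁆,
    ⁅FreeLieAlgebra.of ℤ (1 : Fin 3), ⁅FreeLieAlgebra.of ℤ (1 : Fin 3), FreeLieAlgebra.of ℤ (2 : Fin 3)⁆⁆,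
    ⁅FreeLieAlgebra.of ℤ (2 : Fin 3), ⁅FreeLieAlgebra.of ℤ (0 : Fin 3), FreeLieAlgebra.of ℤ (1 : Fin 3)⁆⁆,
    ⁅FreeLieAlgebra.of ℤ (2 : Fin 3), ⁅FreeLieAlgebra.of ℤ (0 : Fin 3), FreeLieAlgebra.of ℤ (2 : Fin 3)⁆⁆,
    ⁅FreeLieAlgebra.of ℤ (2 : Fin 3), ⁅FreeLieAlgebra.of ℤ (1 : Fin 3), FreeLieAlgebra.of ℤ (2 : Fin 3)⁆⁆] :
      Fin 8 → FreeLieAlgebra ℤ (Fin 3)) l := by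
  obtain ⟨c, hc⟩ := (Submodule.mem_span_range_iff_exists_fun ℤ).1 (L3_le_span hu)
  exact ⟨c, hc.symm⟩

/-! ## Coefficient functionals through Witt's embedding `L ↪ ℤ⟨y₀,y₁,y₂⟩` -/

/-- Words: `y_a · u = y_p · v ↔ a = p ∧ u = v` in the free monoid. [folklore] -/
theorem of_mul_eq_of_mul_iff {α : Type*} (a p : α) (u v : FreeMonoid α) :
    FreeMonoid.of a * u = FreeMonoid.of p * v ↔ a = p ∧ u = v := by
  rw [← FreeMonoid.toList.injective.eq_iff, FreeMonoid.toList_of_mul, FreeMonoid.toList_of_mul,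
    List.cons_eq_cons, FreeMonoid.toList.injective.eq_iff]

/-- Words: `y_a = y_p ↔ a = p`. [folklore] -/
theorem of_eq_of_iff {α : Type*} (a p : α) : FreeMonoid.of a = FreeMonoid.of p ↔ a = p :=
  FreeMonoid.of_injective.eq_iff

/-- Words: `u · y_a = v · y_p ↔ u = v ∧ a = p`. [folklore] -/
theorem mul_of_eq_mul_of_iff {α : Type*} (u v : FreeMonoid α) (a p : α) :
    u * FreeMonoid.of a = v * FreeMonoid.of p ↔ u = v ∧ a = p := by
  constructor
  · intro h
    have h' := congrArg FreeMonoid.toList h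
    rw [FreeMonoid.toList_mul, FreeMonoid.toList_mul, FreeMonoid.toList_of, FreeMonoid.toList_of] at h'
    obtain ⟨h1, h2⟩ := List.append_inj' h' rfl
    exact ⟨FreeMonoid.toList.injective h1, by simpa using h2⟩
  · rintro ⟨rfl, rfl⟩; rfl

/-- **Coefficients of a right-normed triple bracket**: `⁅y_a,⁅y_b,y_c⁆⁆ ↦ abc - acb - bca + cba`. [folklore] -/
theorem tc_lie_lie (a b c p q r : Fin 3) :
    ((toTensor ℤ (Fin 3) (⁅FreeLieAlgebra.of ℤ a, ⁅FreeLieAlgebra.of ℤ b, FreeLieAlgebra.of ℤ c⁆⁆)).coeff (FreeMonoid.of (p) * (FreeMonoid.of (q) * FreeMonoid.of (r)))) =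
      (if a = p ∧ b = q ∧ c = r then 1 else 0) - (if a = p ∧ c = q ∧ b = r then 1 else 0) -
        ((if b = p ∧ c = q ∧ a = r then 1 else 0) - (if c = p ∧ b = q ∧ a = r then 1 else 0)) := by
  classical
  simp only [LieHom.map_lie, toTensor_of, LieRing.of_associative_ring_bracket, mul_sub, sub_mul,
    mul_assoc, MonoidAlgebra.single_mul_single, mul_one, MonoidAlgebra.coeff_sub,
    MonoidAlgebra.coeff_single, Finsupp.sub_apply, Finsupp.single_apply, of_mul_eq_of_mul_iff,
    of_eq_of_iff]

/-- Left multiplication by a letter shifts coefficients: `coeff_{y_p w}(y_i · t) = [i = p] coeff_w(t)`.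
[folklore] -/
theorem coeff_of_mul (i p : Fin 3) (w : FreeMonoid (Fin 3)) (t : MonoidAlgebra ℤ (FreeMonoid (Fin 3))) :
    (MonoidAlgebra.single (FreeMonoid.of i) 1 * t).coeff (FreeMonoid.of p * w) =
      if i = p then t.coeff w else 0 := by
  split_ifs with h
  · subst h
    rw [MonoidAlgebra.coeff_single_mul_eq_mul_coeff w fun m _ => ?_, one_mul]
    rw [of_mul_eq_of_mul_iff]; exact ⟨fun h => h.2, fun h => ⟨rfl, h⟩⟩
  · exact MonoidAlgebra.coeff_single_mul_of_forall_mul_ne _ _ fun d hd =>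
      h ((of_mul_eq_of_mul_iff _ _ _ _).1 hd).1

/-- Right multiplication by a letter shifts coefficients:
`coeff_{y_p y_q y_r y_s}(t · y_i) = [i = s] coeff_{y_p y_q y_r}(t)`. [folklore] -/
theorem coeff_mul_of (i p q r s : Fin 3) (t : MonoidAlgebra ℤ (FreeMonoid (Fin 3))) :
    (t * MonoidAlgebra.single (FreeMonoid.of i) 1).coeff
        (FreeMonoid.of p * (FreeMonoid.of q * (FreeMonoid.of r * FreeMonoid.of s))) =
      if i = s then t.coeff (FreeMonoid.of p * (FreeMonoid.of q * FreeMonoid.of r)) else 0 := by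
  have e : FreeMonoid.of p * (FreeMonoid.of q * (FreeMonoid.of r * FreeMonoid.of s)) =
      (FreeMonoid.of p * (FreeMonoid.of q * FreeMonoid.of r)) * FreeMonoid.of s := by
    simp only [mul_assoc]
  rw [e]
  split_ifs with h
  · subst h
    rw [MonoidAlgebra.coeff_mul_single_eq_coeff_mul _ fun m _ => ?_, mul_one]
    rw [mul_of_eq_mul_of_iff]; exact ⟨fun h => h.1, fun h => ⟨h, rfl⟩⟩
  · exact MonoidAlgebra.coeff_mul_single_of_forall_mul_ne _ _ fun d hd =>
      h ((mul_of_eq_mul_of_iff _ _ _ _).1 hd).2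

/-- **The constraint in coefficients (cyclic symmetry).** If `⁅y₀, D₀⁆ + ⁅D₁, y₁⁆ + ⁅D₂, y₂⁆ = 0`
then for every word `y_p y_q y_r y_s` the six shifted coefficients cancel. [folklore] -/
theorem coeff_constraint (D : Fin 3 → FreeLieAlgebra ℤ (Fin 3))
    (hC : ⁅FreeLieAlgebra.of ℤ (0 : Fin 3), D 0⁆ + ⁅D 1, FreeLieAlgebra.of ℤ (1 : Fin 3)⁆ + ⁅D 2, FreeLieAlgebra.of ℤ (2 : Fin 3)⁆ = 0) (p q r s : Fin 3) :
    ((if (0 : Fin 3) = p then ((toTensor ℤ (Fin 3) (D 0)).coeff (FreeMonoid.of (q) * (FreeMonoid.of (r) * FreeMonoid.of (s)))) else 0) - (if (0 : Fin 3) = s then ((toTensor ℤ (Fin 3) (D 0)).coeff (FreeMonoid.of (p) * (FreeMonoid.of (q) * FreeMonoid.of (r)))) else 0)) +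
      ((if (1 : Fin 3) = s then ((toTensor ℤ (Fin 3) (D 1)).coeff (FreeMonoid.of (p) * (FreeMonoid.of (q) * FreeMonoid.of (r)))) else 0) - (if (1 : Fin 3) = p then ((toTensor ℤ (Fin 3) (D 1)).coeff (FreeMonoid.of (q) * (FreeMonoid.of (r) * FreeMonoid.of (s)))) else 0)) +
      ((if (2 : Fin 3) = s then ((toTensor ℤ (Fin 3) (D 2)).coeff (FreeMonoid.of (p) * (FreeMonoid.of (q) * FreeMonoid.of (r)))) else 0) - (if (2 : Fin 3) = p then ((toTensor ℤ (Fin 3) (D 2)).coeff (FreeMonoid.of (q) * (FreeMonoid.of (r) * FreeMonoid.of (s)))) else 0)) = 0 := by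
  have h := congrArg (fun u => (toTensor ℤ (Fin 3) u).coeff
    (FreeMonoid.of p * (FreeMonoid.of q * (FreeMonoid.of r * FreeMonoid.of s)))) hC
  simpa only [map_add, LieHom.map_lie, toTensor_of, LieRing.of_associative_ring_bracket, map_zero,
    MonoidAlgebra.coeff_add, MonoidAlgebra.coeff_sub, MonoidAlgebra.coeff_zero, Finsupp.add_apply,
    Finsupp.sub_apply, Finsupp.coe_zero, Pi.zero_apply, coeff_of_mul, coeff_mul_of] using h

/-- Coefficients of a combination of basic brackets. [folklore] -/
theorem tc_sum (c : Fin 8 → ℤ) (p q r : Fin 3) :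
    ((toTensor ℤ (Fin 3) (∑ l, c l • (![⁅FreeLieAlgebra.of ℤ (0 : Fin 3), ⁅FreeLieAlgebra.of ℤ (0 : Fin 3), FreeLieAlgebra.of ℤ (1 : Fin 3)⁆⁆,
    ⁅FreeLieAlgebra.of ℤ (0 : Fin 3), ⁅FreeLieAlgebra.of ℤ (0 : Fin 3), FreeLieAlgebra.of ℤ (2 : Fin 3)⁆⁆,
    ⁅FreeLieAlgebra.of ℤ (0 : Fin 3), ⁅FreeLieAlgebra.of ℤ (1 : Fin 3), FreeLieAlgebra.of ℤ (2 : Fin 3)⁆⁆,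
    ⁅FreeLieAlgebra.of ℤ (1 : Fin 3), ⁅FreeLieAlgebra.of ℤ (0 : Fin 3), FreeLieAlgebra.of ℤ (1 : Fin 3)⁆⁆,
    ⁅FreeLieAlgebra.of ℤ (1 : Fin 3), ⁅FreeLieAlgebra.of ℤ (1 : Fin 3), FreeLieAlgebra.of ℤ (2 : Fin 3)⁆⁆,
    ⁅FreeLieAlgebra.of ℤ (2 : Fin 3), ⁅FreeLieAlgebra.of ℤ (0 : Fin 3), FreeLieAlgebra.of ℤ (1 : Fin 3)⁆⁆,
    ⁅FreeLieAlgebra.of ℤ (2 : Fin 3), ⁅FreeLieAlgebra.of ℤ (0 : Fin 3), FreeLieAlgebra.of ℤ (2 : Fin 3)⁆⁆,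
    ⁅FreeLieAlgebra.of ℤ (2 : Fin 3), ⁅FreeLieAlgebra.of ℤ (1 : Fin 3), FreeLieAlgebra.of ℤ (2 : Fin 3)⁆⁆] :
      Fin 8 → FreeLieAlgebra ℤ (Fin 3)) l)).coeff (FreeMonoid.of (p) * (FreeMonoid.of (q) * FreeMonoid.of (r)))) = ∑ l, c l * ((toTensor ℤ (Fin 3) ((![⁅FreeLieAlgebra.of ℤ (0 : Fin 3), ⁅FreeLieAlgebra.of ℤ (0 : Fin 3), FreeLieAlgebra.of ℤ (1 : Fin 3)⁆⁆,
    ⁅FreeLieAlgebra.of ℤ (0 : Fin 3), ⁅FreeLieAlgebra.of ℤ (0 : Fin 3), FreeLieAlgebra.of ℤ (2 : Fin 3)⁆⁆,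
    ⁅FreeLieAlgebra.of ℤ (0 : Fin 3), ⁅FreeLieAlgebra.of ℤ (1 : Fin 3), FreeLieAlgebra.of ℤ (2 : Fin 3)⁆⁆,
    ⁅FreeLieAlgebra.of ℤ (1 : Fin 3), ⁅FreeLieAlgebra.of ℤ (0 : Fin 3), FreeLieAlgebra.of ℤ (1 : Fin 3)⁆⁆,
    ⁅FreeLieAlgebra.of ℤ (1 : Fin 3), ⁅FreeLieAlgebra.of ℤ (1 : Fin 3), FreeLieAlgebra.of ℤ (2 : Fin 3)⁆⁆,
    ⁅FreeLieAlgebra.of ℤ (2 : Fin 3), ⁅FreeLieAlgebra.of ℤ (0 : Fin 3), FreeLieAlgebra.of ℤ (1 : Fin 3)⁆⁆,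
    ⁅FreeLieAlgebra.of ℤ (2 : Fin 3), ⁅FreeLieAlgebra.of ℤ (0 : Fin 3), FreeLieAlgebra.of ℤ (2 : Fin 3)⁆⁆,
    ⁅FreeLieAlgebra.of ℤ (2 : Fin 3), ⁅FreeLieAlgebra.of ℤ (1 : Fin 3), FreeLieAlgebra.of ℤ (2 : Fin 3)⁆⁆] :
      Fin 8 → FreeLieAlgebra ℤ (Fin 3)) l)).coeff (FreeMonoid.of (p) * (FreeMonoid.of (q) * FreeMonoid.of (r)))) := by
  simp only [map_sum, map_zsmul, MonoidAlgebra.coeff_sum, MonoidAlgebra.coeff_smul,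
    Finsupp.finsetSum_apply, Finsupp.smul_apply, smul_eq_mul]

/-! ## The six twist data (in coordinates) and the realisation theorem -/

/-! The SIX TWIST DATA `e(U_k)_j ∈ L₃` (`k < 6` the realiser, `j < 3` the cut letter `b₀, a₁, a₂`):
the degree-two Johnson data, read in `L(S₃ ⧸ N₂)`, of the six separating twists `U_k = x_k T_{h_k} x_k⁻¹`
of the group side (handles `h = 1,2,1,0,1,2` conjugated by the Goeritz elements `z01, z02, e12, z01 z02,
e12⁻¹ z01, e12 z02`) enter through their integer coordinates in the basic brackets, the literal table
`![…] : Fin 6 → Fin 3 → Fin 8 → ℤ` in `lie_realise`. -/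

/-- **Realisation in degree two (`GJ₂` at genus 3, index one).** Every triple `D ∈ L₃³` satisfying
the honest constraint `⁅y₀, D₀⁆ + ⁅D₁, y₁⁆ + ⁅D₂, y₂⁆ = 0` is killed by an INTEGER combination of the
six twist data: `∑_k m_k e(U_k)_j + D_j = 0`, `e(U_k)_j = ∑_l E k j l · (basic bracket l)` with `E` the
literal coordinate table.  (The constraint lattice `D₂(K₂) ⊂ L₃(ℤ³)³ ≅ ℤ²⁴` has
rank `6` and the six data form a `ℤ`-basis of it; the certificate below reads `18` coefficient
identities off the constraint and solves.) [folklore] -/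
theorem lie_realise (D : Fin 3 → FreeLieAlgebra ℤ (Fin 3)) (hD : ∀ j, D j ∈ wordGrade ℤ (FreeLieAlgebra.of ℤ : Fin 3 → FreeLieAlgebra ℤ (Fin 3)) 3)
    (hC : ⁅FreeLieAlgebra.of ℤ (0 : Fin 3), D 0⁆ + ⁅D 1, FreeLieAlgebra.of ℤ (1 : Fin 3)⁆ + ⁅D 2, FreeLieAlgebra.of ℤ (2 : Fin 3)⁆ = 0) :
    ∃ m : Fin 6 → ℤ, ∀ j, (∑ k, m k • ∑ l, (![![![0, 0, 0, -1, 0, 0, 0, 0], ![-1, 0, 0, 0, 0, 0, 0, 0], ![0, 0, 0, 0, 0, 0, 0, 0]],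
    ![![0, 0, 0, 0, 0, 0, -1, 0], ![0, 0, 0, 0, 0, 0, 0, 0], ![0, -1, 0, 0, 0, 0, 0, 0]],
    ![![0, 0, 0, 0, 0, 0, 0, 0], ![0, 0, 0, 0, 0, 0, 0, 1], ![0, 0, 0, 0, -1, 0, 0, 0]],
    ![![0, 0, -1, -1, 0, -2, -1, 0], ![-1, -1, 0, 0, 0, 0, 0, 0], ![-1, -1, 0, 0, 0, 0, 0, 0]],
    ![![0, 0, 0, -1, -1, 0, 0, 0], ![-1, 0, -1, 0, 0, 1, 0, 1], ![0, 0, 0, -1, -1, 0, 0, 0]],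
    ![![0, 0, 0, 0, 0, 0, -1, -1], ![0, 0, 0, 0, 0, 0, 1, 1], ![0, -1, -2, 0, -1, -1, 0, 0]]] : Fin 6 → Fin 3 → Fin 8 → ℤ) k j l • (![⁅FreeLieAlgebra.of ℤ (0 : Fin 3), ⁅FreeLieAlgebra.of ℤ (0 : Fin 3), FreeLieAlgebra.of ℤ (1 : Fin 3)⁆⁆,
    ⁅FreeLieAlgebra.of ℤ (0 : Fin 3), ⁅FreeLieAlgebra.of ℤ (0 : Fin 3), FreeLieAlgebra.of ℤ (2 : Fin 3)⁆⁆,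
    ⁅FreeLieAlgebra.of ℤ (0 : Fin 3), ⁅FreeLieAlgebra.of ℤ (1 : Fin 3), FreeLieAlgebra.of ℤ (2 : Fin 3)⁆⁆,
    ⁅FreeLieAlgebra.of ℤ (1 : Fin 3), ⁅FreeLieAlgebra.of ℤ (0 : Fin 3), FreeLieAlgebra.of ℤ (1 : Fin 3)⁆⁆,
    ⁅FreeLieAlgebra.of ℤ (1 : Fin 3), ⁅FreeLieAlgebra.of ℤ (1 : Fin 3), FreeLieAlgebra.of ℤ (2 : Fin 3)⁆⁆,
    ⁅FreeLieAlgebra.of ℤ (2 : Fin 3), ⁅FreeLieAlgebra.of ℤ (0 : Fin 3), FreeLieAlgebra.of ℤ (1 : Fin 3)⁆⁆,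
    ⁅FreeLieAlgebra.of ℤ (2 : Fin 3), ⁅FreeLieAlgebra.of ℤ (0 : Fin 3), FreeLieAlgebra.of ℤ (2 : Fin 3)⁆⁆,
    ⁅FreeLieAlgebra.of ℤ (2 : Fin 3), ⁅FreeLieAlgebra.of ℤ (1 : Fin 3), FreeLieAlgebra.of ℤ (2 : Fin 3)⁆⁆] :
      Fin 8 → FreeLieAlgebra ℤ (Fin 3)) l) + D j = 0 := by
  choose c hc using fun j => exists_coords (hD j)
  have E := coeff_constraint D hC
  have e1 := E 0 0 0 1
  have e2 := E 0 0 0 2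
  have e3 := E 0 1 1 1
  have e4 := E 0 2 2 2
  have e5 := E 1 1 1 2
  have e6 := E 1 2 2 2
  have e7 := E 0 0 1 1
  have e8 := E 0 0 2 1
  have e9 := E 0 0 2 2
  have e10 := E 0 1 1 2
  have e11 := E 0 2 1 1
  have e12 := E 0 2 2 1
  have e13 := E 1 0 0 2
  have e14 := E 1 0 2 1
  have e15 := E 1 0 2 2
  have e16 := E 1 1 2 2
  have e17 := E 0 0 1 2
  have e18 := E 0 1 2 2
  simp only [hc, tc_sum] at e1 e2 e3 e4 e5 e6 e7 e8 e9 e10 e11 e12 e13 e14 e15 e16 e17 e18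
  simp only [Fin.sum_univ_eight, tc_lie_lie, Matrix.cons_val, Fin.isValue, Fin.reduceEq, and_self, and_true,
    and_false, if_true, if_false, mul_one, mul_zero, add_zero, zero_add, sub_zero, zero_sub, sub_self, mul_neg,
    sub_neg_eq_add] at e1 e2 e3 e4 e5 e6 e7 e8 e9 e10 e11 e12 e13 e14 e15 e16 e17 e18
  refine ⟨![-(c 0 2 - c 0 3 + c 0 4), -(c 0 2 - c 0 6 + c 0 7), -(c 0 4 + c 0 7 + c 1 7), c 0 2, c 0 4, c 0 7],
    fun j => ?_⟩
  have key : ∀ l : Fin 8, (∑ k, (![-(c 0 2 - c 0 3 + c 0 4), -(c 0 2 - c 0 6 + c 0 7), -(c 0 4 + c 0 7 + c 1 7),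
      c 0 2, c 0 4, c 0 7] : Fin 6 → ℤ) k * (![![![0, 0, 0, -1, 0, 0, 0, 0], ![-1, 0, 0, 0, 0, 0, 0, 0], ![0, 0, 0, 0, 0, 0, 0, 0]],
    ![![0, 0, 0, 0, 0, 0, -1, 0], ![0, 0, 0, 0, 0, 0, 0, 0], ![0, -1, 0, 0, 0, 0, 0, 0]],
    ![![0, 0, 0, 0, 0, 0, 0, 0], ![0, 0, 0, 0, 0, 0, 0, 1], ![0, 0, 0, 0, -1, 0, 0, 0]],
    ![![0, 0, -1, -1, 0, -2, -1, 0], ![-1, -1, 0, 0, 0, 0, 0, 0], ![-1, -1, 0, 0, 0, 0, 0, 0]],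
    ![![0, 0, 0, -1, -1, 0, 0, 0], ![-1, 0, -1, 0, 0, 1, 0, 1], ![0, 0, 0, -1, -1, 0, 0, 0]],
    ![![0, 0, 0, 0, 0, 0, -1, -1], ![0, 0, 0, 0, 0, 0, 1, 1], ![0, -1, -2, 0, -1, -1, 0, 0]]] : Fin 6 → Fin 3 → Fin 8 → ℤ) k j l) + c j l = 0 := by
    intro l
    fin_cases j <;> fin_cases l <;>
      simp only [Fin.sum_univ_six, Matrix.cons_val, Fin.zero_eta, Fin.mk_one, Fin.reduceFinMk, Fin.isValue,
        mul_one, mul_zero, mul_neg, add_zero, zero_add] <;>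
      linarith
  calc (∑ k, (![-(c 0 2 - c 0 3 + c 0 4), -(c 0 2 - c 0 6 + c 0 7), -(c 0 4 + c 0 7 + c 1 7), c 0 2, c 0 4, c 0 7] :
          Fin 6 → ℤ) k • ∑ l, (![![![0, 0, 0, -1, 0, 0, 0, 0], ![-1, 0, 0, 0, 0, 0, 0, 0], ![0, 0, 0, 0, 0, 0, 0, 0]],
    ![![0, 0, 0, 0, 0, 0, -1, 0], ![0, 0, 0, 0, 0, 0, 0, 0], ![0, -1, 0, 0, 0, 0, 0, 0]],
    ![![0, 0, 0, 0, 0, 0, 0, 0], ![0, 0, 0, 0, 0, 0, 0, 1], ![0, 0, 0, 0, -1, 0, 0, 0]],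
    ![![0, 0, -1, -1, 0, -2, -1, 0], ![-1, -1, 0, 0, 0, 0, 0, 0], ![-1, -1, 0, 0, 0, 0, 0, 0]],
    ![![0, 0, 0, -1, -1, 0, 0, 0], ![-1, 0, -1, 0, 0, 1, 0, 1], ![0, 0, 0, -1, -1, 0, 0, 0]],
    ![![0, 0, 0, 0, 0, 0, -1, -1], ![0, 0, 0, 0, 0, 0, 1, 1], ![0, -1, -2, 0, -1, -1, 0, 0]]] : Fin 6 → Fin 3 → Fin 8 → ℤ) k j l • (![⁅FreeLieAlgebra.of ℤ (0 : Fin 3), ⁅FreeLieAlgebra.of ℤ (0 : Fin 3), FreeLieAlgebra.of ℤ (1 : Fin 3)⁆⁆,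
    ⁅FreeLieAlgebra.of ℤ (0 : Fin 3), ⁅FreeLieAlgebra.of ℤ (0 : Fin 3), FreeLieAlgebra.of ℤ (2 : Fin 3)⁆⁆,
    ⁅FreeLieAlgebra.of ℤ (0 : Fin 3), ⁅FreeLieAlgebra.of ℤ (1 : Fin 3), FreeLieAlgebra.of ℤ (2 : Fin 3)⁆⁆,
    ⁅FreeLieAlgebra.of ℤ (1 : Fin 3), ⁅FreeLieAlgebra.of ℤ (0 : Fin 3), FreeLieAlgebra.of ℤ (1 : Fin 3)⁆⁆,
    ⁅FreeLieAlgebra.of ℤ (1 : Fin 3), ⁅FreeLieAlgebra.of ℤ (1 : Fin 3), FreeLieAlgebra.of ℤ (2 : Fin 3)⁆⁆,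
    ⁅FreeLieAlgebra.of ℤ (2 : Fin 3), ⁅FreeLieAlgebra.of ℤ (0 : Fin 3), FreeLieAlgebra.of ℤ (1 : Fin 3)⁆⁆,
    ⁅FreeLieAlgebra.of ℤ (2 : Fin 3), ⁅FreeLieAlgebra.of ℤ (0 : Fin 3), FreeLieAlgebra.of ℤ (2 : Fin 3)⁆⁆,
    ⁅FreeLieAlgebra.of ℤ (2 : Fin 3), ⁅FreeLieAlgebra.of ℤ (1 : Fin 3), FreeLieAlgebra.of ℤ (2 : Fin 3)⁆⁆] :
      Fin 8 → FreeLieAlgebra ℤ (Fin 3)) l) + D j = ∑ l, ((∑ k, (![-(c 0 2 - c 0 3 + c 0 4), -(c 0 2 - c 0 6 + c 0 7),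
          -(c 0 4 + c 0 7 + c 1 7), c 0 2, c 0 4, c 0 7] : Fin 6 → ℤ) k * (![![![0, 0, 0, -1, 0, 0, 0, 0], ![-1, 0, 0, 0, 0, 0, 0, 0], ![0, 0, 0, 0, 0, 0, 0, 0]],
    ![![0, 0, 0, 0, 0, 0, -1, 0], ![0, 0, 0, 0, 0, 0, 0, 0], ![0, -1, 0, 0, 0, 0, 0, 0]],
    ![![0, 0, 0, 0, 0, 0, 0, 0], ![0, 0, 0, 0, 0, 0, 0, 1], ![0, 0, 0, 0, -1, 0, 0, 0]],
    ![![0, 0, -1, -1, 0, -2, -1, 0], ![-1, -1, 0, 0, 0, 0, 0, 0], ![-1, -1, 0, 0, 0, 0, 0, 0]],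
    ![![0, 0, 0, -1, -1, 0, 0, 0], ![-1, 0, -1, 0, 0, 1, 0, 1], ![0, 0, 0, -1, -1, 0, 0, 0]],
    ![![0, 0, 0, 0, 0, 0, -1, -1], ![0, 0, 0, 0, 0, 0, 1, 1], ![0, -1, -2, 0, -1, -1, 0, 0]]] : Fin 6 → Fin 3 → Fin 8 → ℤ) k j l) + c j l) • (![⁅FreeLieAlgebra.of ℤ (0 : Fin 3), ⁅FreeLieAlgebra.of ℤ (0 : Fin 3), FreeLieAlgebra.of ℤ (1 : Fin 3)⁆⁆,
    ⁅FreeLieAlgebra.of ℤ (0 : Fin 3), ⁅FreeLieAlgebra.of ℤ (0 : Fin 3), FreeLieAlgebra.of ℤ (2 : Fin 3)⁆⁆,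
    ⁅FreeLieAlgebra.of ℤ (0 : Fin 3), ⁅FreeLieAlgebra.of ℤ (1 : Fin 3), FreeLieAlgebra.of ℤ (2 : Fin 3)⁆⁆,
    ⁅FreeLieAlgebra.of ℤ (1 : Fin 3), ⁅FreeLieAlgebra.of ℤ (0 : Fin 3), FreeLieAlgebra.of ℤ (1 : Fin 3)⁆⁆,
    ⁅FreeLieAlgebra.of ℤ (1 : Fin 3), ⁅FreeLieAlgebra.of ℤ (1 : Fin 3), FreeLieAlgebra.of ℤ (2 : Fin 3)⁆⁆,
    ⁅FreeLieAlgebra.of ℤ (2 : Fin 3), ⁅FreeLieAlgebra.of ℤ (0 : Fin 3), FreeLieAlgebra.of ℤ (1 : Fin 3)⁆⁆,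
    ⁅FreeLieAlgebra.of ℤ (2 : Fin 3), ⁅FreeLieAlgebra.of ℤ (0 : Fin 3), FreeLieAlgebra.of ℤ (2 : Fin 3)⁆⁆,
    ⁅FreeLieAlgebra.of ℤ (2 : Fin 3), ⁅FreeLieAlgebra.of ℤ (1 : Fin 3), FreeLieAlgebra.of ℤ (2 : Fin 3)⁆⁆] :
      Fin 8 → FreeLieAlgebra ℤ (Fin 3)) l := by
        conv_lhs => rw [hc j]
        simp only [Finset.smul_sum, smul_smul, add_smul, Finset.sum_add_distrib, Finset.sum_smul]
        rw [Finset.sum_comm]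
    _ = 0 := Finset.sum_eq_zero fun l _ => by rw [key l, zero_smul]

end LayerZeroOne


/-- **Registered helper `helper_layerZeroOneLieSpan`** (sub-goal of stub `stub_layerStepZeroOne`, item
stmt-SmoothPoincare4-14595): the degree-`3` piece of the free Lie ring on three letters is spanned over `ℤ`
by the eight right-normed basic brackets. [folklore] -/
theorem helper_layerZeroOneLieSpan : ∀ u ∈ Literature.Algebra.Lie.wordGrade ℤ (FreeLieAlgebra.of ℤ : Fin 3 → FreeLieAlgebra ℤ (Fin 3)) 3, ∃ c : Fin 8 → ℤ, u = c 0 • ⁅FreeLieAlgebra.of ℤ (0 : Fin 3), ⁅FreeLieAlgebra.of ℤ (0 : Fin 3), FreeLieAlgebra.of ℤ (1 : Fin 3)⁆⁆ + c 1 • ⁅FreeLieAlgebra.of ℤ (0 : Fin 3), ⁅FreeLieAlgebra.of ℤ (0 : Fin 3), FreeLieAlgebra.of ℤ (2 : Fin 3)⁆⁆ + c 2 • ⁅FreeLieAlgebra.of ℤ (0 : Fin 3), ⁅FreeLieAlgebra.of ℤ (1 : Fin 3), FreeLieAlgebra.of ℤ (2 : Fin 3)⁆⁆ + c 3 • ⁅FreeLieAlgebra.of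 ℤ (1 : Fin 3), ⁅FreeLieAlgebra.of ℤ (0 : Fin 3), FreeLieAlgebra.of ℤ (1 : Fin 3)⁆⁆ + c 4 • ⁅FreeLieAlgebra.of ℤ (1 : Fin 3), ⁅FreeLieAlgebra.of ℤ (1 : Fin 3), FreeLieAlgebra.of ℤ (2 : Fin 3)⁆⁆ + c 5 • ⁅FreeLieAlgebra.of ℤ (2 : Fin 3), ⁅FreeLieAlgebra.of ℤ (0 : Fin 3), FreeLieAlgebra.of ℤ (1 : Fin 3)⁆⁆ + c 6 • ⁅FreeLieAlgebra.of ℤ (2 : Fin 3), ⁅FreeLieAlgebra.of ℤ (0 : Fin 3), FreeLieAlgebra.of ℤ (2 : Fin 3)⁆⁆ + c 7 • ⁅FreeLieAlgebra.of ℤ (2 : Fin 3), ⁅FreeLieAlgebra.of ℤ (1 : Fin 3), FreeLieAlgebra.of ℤ (2 : Fin 3)⁆⁆ := by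
  intro u hu
  obtain ⟨c, hc⟩ := LayerZeroOne.exists_coords hu
  refine ⟨c, ?_⟩
  rw [hc]
  simp only [Fin.sum_univ_eight, Matrix.cons_val]

end Summit.SmoothPoincare4.SmoothPoincare4.Theorems.ShadowApproximation.NilpotentGenusClass

end
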